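import Summits.NavierStokesRegularity.NavierStokesRegularity.Theses.PerpetualPump
import Summits.NavierStokesRegularity.NavierStokesRegularity.Theorems.PerpetualPumpEulerTypeIGlueDensity
import Summits.NavierStokesRegularity.NavierStokesRegularity.Theorems.PerpetualPumpEulerTypeIGlueSobolevR3
import Summits.NavierStokesRegularity.NavierStokesRegularity.Theorems.PerpetualPumpEulerTypeIGlueDuhamel
import Summits.NavierStokesRegularity.NavierStokesRegularity.Theorems.PerpetualPumpEulerTypeIGlueTrilinearPrep
import Literature.Analysis.FluidPDE.NSCriticalClosureBesovKatoClass
import Literature.Analysis.FluidPDE.KNSSTypeIIHolds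
import Literature.Analysis.FluidPDE.TaoAveragedSobolevProofs
import Literature.Analysis.FluidPDE.TaoMildSolutionBounds
import Literature.Analysis.FluidPDE.TaoCascadeProjection
import Summits.NavierStokesRegularity.NavierStokesRegularity.Theorems.PerpetualPumpEulerTypeIGlueMemH10
import Summits.NavierStokesRegularity.NavierStokesRegularity.Theorems.PerpetualPumpEulerTypeIGlueBackEnd
import Summits.NavierStokesRegularity.NavierStokesRegularity.Theorems.PerpetualPumpEulerTypeIGlueContinuity
import Summits.NavierStokesRegularity.NavierStokesRegularity.Theorems.PerpetualPumpEulerTypeIGlueIdentityTests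
import Summits.NavierStokesRegularity.NavierStokesRegularity.Theorems.PerpetualPumpEulerTypeIGlueNormalise
import Summits.NavierStokesRegularity.NavierStokesRegularity.Theorems.PerpetualPumpEulerTypeIGlueTestToH10
import Summits.NavierStokesRegularity.NavierStokesRegularity.Theorems.PerpetualPumpEulerTypeIGlueCubic

/-!
# Line `Sketch` for crux `PerpetualPump.EulerTypeIGlue` (stmt-NavierStokesRegularity-1838) —
# LEAD'S SKELETON (prover-line-stmt-NavierStokesRegularity-1838-0, 2026-08-16)

`EulerTypeIGlue := Thesis → NoTypeIClay`: Tao's abstract Type-I exclusion, instantiated at the Euler datum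
(`AveragingDatum.euler`, `euler_form = eulerForm`), gives "no Type-I blow-up for classical Leray–Hopf
solutions from rapidly decaying data". The line (cards `pair-kato-mild-identity` front end +
`h10-continuity-certificate` back end, crux-ideate r1 ideator 1):

1. **x-mild is input.** The classical Leray–Hopf solution `u` on `[0,T)` is a duality-form mild solution
   (`isKatoSolutionOn_of_classical`, PROVED): for every `φ ∈ C_{c,σ}^∞`,
   `∫⟪u t, φ⟫ = ∫⟪u 0, e^{νtΔ}φ⟫ + ∫₀ᵗ ∫⟪u τ, (u τ·∇) e^{ν(t-τ)Δ}φ⟫ dτ`.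
2. **Two Plancherel dictionaries** carry it to Tao's side for the curve `U t = [(u t)^ℂ] ∈ L²(ℝ³;ℂ³)`:
   heat (`heat_toLp_eq_toLp_heatFlow`, landed) and the CUBIC identity
   `⟨B([f^ℂ],[f^ℂ]),[ψ^ℂ]⟩ = ∫⟪f,(f·∇)ψ⟫` (`stub_cubic`, the lead's stub; TrilinearPrep/TripleProduct landed)
   ⇒ Tao's (1.15) at viscosity `ν` for test fields (`stub_identityTests`).
3. **`L²` closure of the test class** (`stub_testToH10`): both sides are `L²`-continuous in `w` (two `H¹⁰`
   slots of the trilinear form, `norm_eulerForm_le`), and `C_{c,σ}^∞` is `L²`-dense in the real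
   Fourier-divergence-free classes (`exists_divFreeTest_tendsto`, landed).
4. **Regularity bookkeeping** from the PROVED slab theorems (`tao2011_hasBoundedSobolevNormsOn_holds`,
   `continuousInLpOn_slab_of_classical`): `U t ∈ H¹⁰_df` (`stub_memH10`) and `U ∈ C_t H¹⁰`
   (`stub_continuity`, Fourier-side interpolation between `C_t L²` and `L^∞_t H^{20}`).
5. **Viscosity normalised on Tao's side** by the time rescaling `W s = ν⁻¹ • U (s/ν)` on `[0, νT)`
   (`stub_normalise`: trilinearity + `∫` substitution; datum `schwartzL2 (ν⁻¹ • u₀)`, rate `ν^{-1/2}M/√(νT-s)`).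
6. **Thesis** at `𝒜 = euler` gives a mild `H¹⁰_df` extension `v` on `[0,T')`, `T' > νT`, `v = W` on `[0,νT)`.
7. **Back end** (`stub_backEnd`): `H¹⁰`-continuity of `v` at `νT` ⇒ `‖u t‖_∞` bounded near `T`
   (`eLpNorm_top_le_sobolevTen`); slab bound below; `hasSmoothExtensionPast_of_bounded_holds` (RRS 8.17, PROVED)
   ⇒ `HasSmoothExtensionPast ν 0 u T`. No mild ⇒ classical upgrade anywhere.

Registered stubs (7 = stubs_max): `stub_cubic` (lead), `stub_identityTests`, `stub_testToH10`, `stub_memH10`,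
`stub_continuity`, `stub_normalise`, `stub_backEnd`; each lands verbatim as `theorem stub_<name>` in
`Theorems/PerpetualPumpEulerTypeIGlue<Name>.lean`
(namespace `Summit.NavierStokesRegularity.NavierStokesRegularity.Theorems.PerpetualPumpEulerTypeIGlue`).
All seven stubs are landed (p99159, p97455, p97593, p97126, p97437, p97484, p97151); the composition
`EulerTypeIGlue_of` below is sorry-free. Closing file: `Theorems/PerpetualPumpEulerTypeIGlue.lean`
(`perpetualPump_eulerTypeIGlue_proof`).

Disproof used: none — no `Disproof.lean` / Negative lemma exists for this crux (2026-08-16, `ledger crux ls`).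
-/

noncomputable section

open MeasureTheory Set Filter Topology FourierTransform
open scoped ENNReal NNReal RealInnerProductSpace SchwartzMap ContDiff

set_option linter.dupNamespace false

namespace Summit.NavierStokesRegularity.NavierStokesRegularity.Cruxes.EulerTypeIGlue.Lines.Sketch

open Literature.Analysis.FluidPDE Literature.Analysis.FluidPDE.Tao2016
open Literature.Analysis.FunctionSpaces (eFourierSobolevNorm)
open Literature.Analysis.FunctionSpaces.EuclideanSpace (complexify complexify_apply norm_complexify
  continuous_complexify)
open Summit.NavierStokesRegularity.NavierStokesRegularity.Theorems.PerpetualPumpEulerTypeIGlue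

/-- Local notation for physical / frequency space `ℝ³`. -/
local notation "ℝ³" => EuclideanSpace ℝ (Fin 3)
/-- Local notation for the complexified range `ℂ³`. -/
local notation "ℂ³" => EuclideanSpace ℂ (Fin 3)

/-! ## The REGISTERED stubs (all LANDED; each delegates to its Theorems file) -/

/-- **S1 (K1, lead's stub) — the cubic Plancherel identity**: for a continuous real field `f` whose
complexified `L²` class is in `H¹⁰` and Fourier-divergence-free, and a `C¹` field `ψ` with `ψ, Dψ ∈ L¹`,
`ψ^ℂ ∈ L²`: `⟨B([f^ℂ],[f^ℂ]), [ψ^ℂ]⟩ = ∫ ⟪f, (f·∇)ψ⟫` (Tao 2016 (1.3)–(1.4) versus the x-space form;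
sign/`2π` normalisation confirmed by kit j015106). [cite: Tao2016AveragedNS, §1.1 (1.3)-(1.4)] -/
theorem stub_cubic {f ψ : ℝ³ → ℝ³} (hf : Continuous f)
    (h2 : MemLp (complexify ∘ f) 2 (volume : Measure ℝ³))
    (hH : eFourierSobolevNorm 10 (h2.toLp _) < ⊤) (hdf : IsFourierDivFree (h2.toLp _))
    (hψ : ContDiff ℝ 1 ψ) (hψ1 : Integrable ψ) (hψ' : Integrable (fderiv ℝ ψ))
    (hψ2 : MemLp (complexify ∘ ψ) 2 (volume : Measure ℝ³)) :
    eulerForm (h2.toLp _) (h2.toLp _) (hψ2.toLp _) = ((∫ x, ⟪f x, convect f ψ x⟫ : ℝ) : ℂ) :=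
  -- LANDED: Theorems/PerpetualPumpEulerTypeIGlueCubic.lean (p99159)
  _root_.Summit.NavierStokesRegularity.NavierStokesRegularity.Theorems.PerpetualPumpEulerTypeIGlue.stub_cubic hf h2 hH hdf hψ hψ1 hψ' hψ2

/-- **S2 — Tao's identity (1.15) at viscosity `ν` for divergence-free test fields**: for the complexified
curve `U t = [(u t)^ℂ]` of a classical Leray–Hopf solution, every `t ∈ [0,T)` and every `φ ∈ C_{c,σ}^∞`,
`⟨U t, φ⟩ = ⟨e^{νtΔ} U 0, φ⟩ + ∫₀ᵗ ⟨B(U s, U s), e^{ν(t-s)Δ} φ⟩ ds` (x-mild identity of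
`isKatoSolutionOn_of_classical` + heat dictionary + the cubic identity `hcubic`).
[cite: Tao2016AveragedNS, §1.1 (1.5), (1.15)] -/
theorem stub_identityTests {ν T : ℝ} (hν : 0 < ν) (hT : 0 < T) {u : ℝ → ℝ³ → ℝ³} {p : ℝ → ℝ³ → ℝ}
    (hcl : IsClassicalNSSolutionOn (Ico 0 T) ν 0 u p) (hLH : IsLerayHopfOn T ν 0 (u 0) u)
    (hdec : HasRapidSpatialDecay (u 0)) (U : ℝ → L2C)
    (hU : ∀ t ∈ Ico 0 T, ((U t : L2C) : ℝ³ → ℂ³) =ᵐ[volume] complexify ∘ u t)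
    (hH : ∀ t ∈ Ico 0 T, MemH10df (U t))
    (hcubic : ∀ {f ψ : ℝ³ → ℝ³} (_ : Continuous f) (h2 : MemLp (complexify ∘ f) 2 (volume : Measure ℝ³))
      (_ : eFourierSobolevNorm 10 (h2.toLp _) < ⊤) (_ : IsFourierDivFree (h2.toLp _))
      (_ : ContDiff ℝ 1 ψ) (_ : Integrable ψ) (_ : Integrable (fderiv ℝ ψ))
      (hψ2 : MemLp (complexify ∘ ψ) 2 (volume : Measure ℝ³)),
      eulerForm (h2.toLp _) (h2.toLp _) (hψ2.toLp _) = ((∫ x, ⟪f x, convect f ψ x⟫ : ℝ) : ℂ)) :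
    ∀ t ∈ Ico 0 T, ∀ φ ∈ divFreeTest ℝ³, ∀ (h2φ : MemLp (complexify ∘ φ) 2 (volume : Measure ℝ³)),
      pairing (U t) (h2φ.toLp _) = pairing (heat (ν * t) (U 0)) (h2φ.toLp _) +
        ∫ s in (0:ℝ)..t, eulerForm (U s) (U s) (heat (ν * (t - s)) (h2φ.toLp _)) :=
  -- LANDED: Theorems/PerpetualPumpEulerTypeIGlueIdentityTests.lean (p97455)
  _root_.Summit.NavierStokesRegularity.NavierStokesRegularity.Theorems.PerpetualPumpEulerTypeIGlue.stub_identityTests hν hT hcl hLH hdec U hU hH hcubic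

/-- **S3 — from test fields to all of `H¹⁰_df`**: Tao's identity at viscosity `ν`, known for every
`φ ∈ C_{c,σ}^∞`, holds for every `w ∈ H¹⁰_df` (both sides are `L²`-continuous in `w` by
`norm_eulerForm_le` and the `L²`-contractivity of `e^{τΔ}`; `C_{c,σ}^∞` is `L²`-dense in the real
Fourier-divergence-free classes, `exists_divFreeTest_tendsto`). [cite: Tao2016AveragedNS, §1.1 (1.15)] -/
theorem stub_testToH10 {ν T : ℝ} (U : ℝ → L2C)
    (hH : ∀ t ∈ Ico 0 T, MemH10df (U t)) (hc : ContinuousInH10On (Ico 0 T) U)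
    (htest : ∀ t ∈ Ico 0 T, ∀ φ ∈ divFreeTest ℝ³, ∀ (h2φ : MemLp (complexify ∘ φ) 2 (volume : Measure ℝ³)),
      pairing (U t) (h2φ.toLp _) = pairing (heat (ν * t) (U 0)) (h2φ.toLp _) +
        ∫ s in (0:ℝ)..t, eulerForm (U s) (U s) (heat (ν * (t - s)) (h2φ.toLp _))) :
    ∀ t ∈ Ico 0 T, ∀ w, MemH10df w →
      pairing (U t) w = pairing (heat (ν * t) (U 0)) w +
        ∫ s in (0:ℝ)..t, eulerForm (U s) (U s) (heat (ν * (t - s)) w) :=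
  -- LANDED: Theorems/PerpetualPumpEulerTypeIGlueTestToH10.lean (p97593)
  _root_.Summit.NavierStokesRegularity.NavierStokesRegularity.Theorems.PerpetualPumpEulerTypeIGlue.stub_testToH10 U hH hc htest

/-- **S4 — `H¹⁰_df` membership of the slices**: `U t ∈ H¹⁰_df` for `t ∈ [0,T)` (slab Sobolev bounds
`tao2011_hasBoundedSobolevNormsOn_holds` + the landed `memH10df_toLp_complexify`).
[cite: Tao2016AveragedNS, §1.1 p. 3] -/
theorem stub_memH10 {ν T : ℝ} (hν : 0 < ν) {u : ℝ → ℝ³ → ℝ³} {p : ℝ → ℝ³ → ℝ}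
    (hcl : IsClassicalNSSolutionOn (Ico 0 T) ν 0 u p) (hLH : IsLerayHopfOn T ν 0 (u 0) u)
    (hdec : HasRapidSpatialDecay (u 0)) (U : ℝ → L2C)
    (hU : ∀ t ∈ Ico 0 T, ((U t : L2C) : ℝ³ → ℂ³) =ᵐ[volume] complexify ∘ u t) :
    ∀ t ∈ Ico 0 T, MemH10df (U t) :=
  -- LANDED: Theorems/PerpetualPumpEulerTypeIGlueMemH10.lean (p97126)
  _root_.Summit.NavierStokesRegularity.NavierStokesRegularity.Theorems.PerpetualPumpEulerTypeIGlue.stub_memH10 hν hcl hLH hdec U hU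

/-- **S5 — continuity of `t ↦ U t` in `H¹⁰` on `[0,T)`**: Fourier-side interpolation
`‖g‖²_{H¹⁰} ≤ ‖g‖_{L²} ‖g‖_{H²⁰}` between the slab facts `u ∈ C([0,T₁]; L²)`
(`continuousInLpOn_slab_of_classical`) and `u ∈ L^∞([0,T₁]; H²⁰)` (`tao2011_hasBoundedSobolevNormsOn_holds`,
`eFourierSobolevNorm_sq_le`). [cite: Tao2011, Cor. 11.1 + Thm. 5.4 (iv)] -/
theorem stub_continuity {ν T : ℝ} (hν : 0 < ν) (hT : 0 < T) {u : ℝ → ℝ³ → ℝ³} {p : ℝ → ℝ³ → ℝ}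
    (hcl : IsClassicalNSSolutionOn (Ico 0 T) ν 0 u p) (hLH : IsLerayHopfOn T ν 0 (u 0) u)
    (hdec : HasRapidSpatialDecay (u 0)) (U : ℝ → L2C)
    (hU : ∀ t ∈ Ico 0 T, ((U t : L2C) : ℝ³ → ℂ³) =ᵐ[volume] complexify ∘ u t) :
    ContinuousInH10On (Ico 0 T) U :=
  -- LANDED: Theorems/PerpetualPumpEulerTypeIGlueContinuity.lean (p97437)
  _root_.Summit.NavierStokesRegularity.NavierStokesRegularity.Theorems.PerpetualPumpEulerTypeIGlue.stub_continuity hν hT hcl hLH hdec U hU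

/-- **S6 — viscosity normalisation on Tao's side**: if `U` solves Tao's mild identity at viscosity `ν` on
`[0,T)` with datum `schwartzL2 u₀` and obeys the `L^∞` rate `M/√(T-t)`, then the time-rescaled curve
`W s = ν⁻¹ • U (s/ν)` is an `H¹⁰_df`-mild solution of the (unit-viscosity) Euler-datum equation on `[0, νT)`
from `schwartzL2 (ν⁻¹ • u₀)`, with the rate `ν^{-1/2} M/√(νT - s)` (trilinearity of `B`, linearity of
`e^{τΔ}`, the substitution `τ = σ/ν`; `AveragingDatum.euler_form`). [cite: Tao2016AveragedNS, §1.1 (1.15) and p. 6 (euler datum)] -/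
theorem stub_normalise {ν T : ℝ} (hν : 0 < ν) (u₀ : 𝓢(ℝ³, ℝ³)) (U : ℝ → L2C)
    (hU0 : U 0 = schwartzL2 u₀)
    (hH : ∀ t ∈ Ico 0 T, MemH10df (U t)) (hc : ContinuousInH10On (Ico 0 T) U)
    (hid : ∀ t ∈ Ico 0 T, ∀ w, MemH10df w →
      pairing (U t) w = pairing (heat (ν * t) (U 0)) w +
        ∫ s in (0:ℝ)..t, eulerForm (U s) (U s) (heat (ν * (t - s)) w))
    (hrate : ∃ M : ℝ, ∀ t ∈ Ico 0 T, eLpNorm (U t) ⊤ volume ≤ ENNReal.ofReal (M / Real.sqrt (T - t))) :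
    AveragingDatum.euler.IsMildSolution (schwartzL2 ((ν⁻¹ : ℝ) • u₀)) (Ico 0 (ν * T))
        (fun s => ((ν⁻¹ : ℝ) : ℂ) • U (s / ν)) ∧
      ∃ M : ℝ, ∀ s ∈ Ico 0 (ν * T),
        eLpNorm ((((ν⁻¹ : ℝ) : ℂ) • U (s / ν) : L2C)) ⊤ volume ≤
          ENNReal.ofReal (M / Real.sqrt (ν * T - s)) :=
  -- LANDED: Theorems/PerpetualPumpEulerTypeIGlueNormalise.lean (p97484)
  _root_.Summit.NavierStokesRegularity.NavierStokesRegularity.Theorems.PerpetualPumpEulerTypeIGlue.stub_normalise hν u₀ U hU0 hH hc hid hrate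

/-- **S7 — the back end (card `h10-continuity-certificate`)**: a mild `H¹⁰_df` curve `v` on `[0,T')`,
`T' > bT`, whose slices `v (b t)`, `t ∈ [0,T)`, are `a • (u t)^ℂ` (`a, b > 0`), certifies that the classical
Leray–Hopf solution `u` is bounded on `[0,T) × ℝ³` (`H¹⁰`-continuity of `v` at `bT` + `H¹⁰ ⊂ L^∞` near `T`,
slab bound `exists_forall_norm_le_of_tao2011` below), hence extends classically past `T`
(`hasSmoothExtensionPast_of_bounded_holds`, Robinson–Rodrigo–Sadowski 2016 Thm. 8.17).
[cite: RobinsonRodrigoSadowski2016, Thm 8.17 with Thms 6.15, 6.10, 7.5] -/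
theorem stub_backEnd {ν T T' a b : ℝ} (hν : 0 < ν) (hT : 0 < T) (ha : 0 < a) (hb : 0 < b)
    (hbT : b * T < T') {u : ℝ → ℝ³ → ℝ³} {p : ℝ → ℝ³ → ℝ}
    (hcl : IsClassicalNSSolutionOn (Ico 0 T) ν 0 u p) (hLH : IsLerayHopfOn T ν 0 (u 0) u)
    (hdec : HasRapidSpatialDecay (u 0)) (v : ℝ → L2C)
    (hvH : ∀ s ∈ Ico 0 T', MemH10df (v s)) (hvc : ContinuousInH10On (Ico 0 T') v)
    (hagree : ∀ t ∈ Ico 0 T, ((v (b * t) : L2C) : ℝ³ → ℂ³) =ᵐ[volume]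
      fun x => ((a : ℝ) : ℂ) • complexify (u t x)) :
    HasSmoothExtensionPast ν 0 u T :=
  -- LANDED: Theorems/PerpetualPumpEulerTypeIGlueBackEnd.lean (p97151)
  _root_.Summit.NavierStokesRegularity.NavierStokesRegularity.Theorems.PerpetualPumpEulerTypeIGlue.stub_backEnd hν hT ha hb hbT hcl hLH hdec v hvH hvc hagree

/-! ## Small proved helpers for the composition -/

/-- A smooth rapidly decaying field is (the coercion of) a Schwartz map. [folklore] -/
theorem exists_schwartzMap_coe_eq {u₀ : ℝ³ → ℝ³} (hu : ContDiff ℝ ∞ u₀)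
    (hdec : HasRapidSpatialDecay u₀) : ∃ f : 𝓢(ℝ³, ℝ³), ⇑f = u₀ := by
  refine ⟨⟨u₀, hu, fun k n => ?_⟩, rfl⟩
  obtain ⟨C, hC⟩ := hdec n k
  refine ⟨C, fun x => le_trans ?_ (hC x)⟩
  exact mul_le_mul_of_nonneg_right
    (pow_le_pow_left₀ (norm_nonneg _) (le_add_of_nonneg_left zero_le_one) k) (norm_nonneg _)

/-- A scalar multiple of a smooth divergence-free field is divergence free. [folklore] -/
theorem isDivFree_const_smul {v : ℝ³ → ℝ³} (hv : ContDiff ℝ 1 v) (hdiv : VectorCalculus.IsDivFree v)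
    (c : ℝ) : VectorCalculus.IsDivFree (c • v) := by
  intro x
  have hd : DifferentiableAt ℝ v x := (hv.differentiable one_ne_zero).differentiableAt
  have hx := hdiv x
  unfold VectorCalculus.divergence at hx ⊢
  have h1 : HasFDerivAt (c • v) (c • fderiv ℝ v x) x := hd.hasFDerivAt.const_smul c
  rw [h1.fderiv, ContinuousLinearMap.toLinearMap_smul, map_smul, hx, smul_zero]

/-- Slab bounds for all `T₁ < T` (not only `0 < T₁`). [folklore] -/
theorem forall_lt_exists_bound {T : ℝ} (hT : 0 < T) {u : ℝ → ℝ³ → ℝ³}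
    (h : ∀ T₁ ∈ Ioo 0 T, ∃ M : ℝ, ∀ t ∈ Icc 0 T₁, ∀ x, ‖u t x‖ ≤ M) :
    ∀ T₁ < T, ∃ M : ℝ, ∀ t ∈ Icc 0 T₁, ∀ x, ‖u t x‖ ≤ M := by
  intro T₁ hT₁
  obtain ⟨M, hM⟩ := h (max T₁ (T / 2)) ⟨lt_max_of_lt_right (by linarith), max_lt hT₁ (by linarith)⟩
  exact ⟨M, fun t ht x => hM t ⟨ht.1, ht.2.trans (le_max_left _ _)⟩ x⟩

/-! ## The composition (PROVED modulo the stubs) -/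

/-- **`EulerTypeIGlue` from the seven stubs.** [cite: Tao2016AveragedNS, §1.1 (1.15); RobinsonRodrigoSadowski2016, Thm 8.17] -/
theorem EulerTypeIGlue_of : Theses.PerpetualPump.EulerTypeIGlue := by
  intro hTh ν T hν hT u p hcl hLH hdec hTI
  -- (0) slab bounds and the Type-I rate on all of `[0,T)`
  have hslab := exists_forall_norm_le_of_tao2011 tao2011_hasBoundedSobolevNormsOn_holds hν hcl hLH hdec
  obtain ⟨C, hC⟩ := hTI.exists_sqrt_mul_norm_le (forall_lt_exists_bound hT hslab)
  -- (1) the Tao-side curve `U t = [(u t)^ℂ]`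
  have h2 : ∀ t ∈ Ico 0 T, MemLp (complexify ∘ u t) 2 (volume : Measure ℝ³) := fun t ht =>
    memLp_complexify_of_memLp (hLH.memLp t ⟨ht.1, ht.2.le⟩)
  classical
  set U : ℝ → L2C := fun t => if ht : t ∈ Ico 0 T then (h2 t ht).toLp _ else 0 with hUdef
  have hU_eq : ∀ t (ht : t ∈ Ico 0 T), U t = (h2 t ht).toLp _ := fun t ht => by
    simp only [hUdef, dif_pos ht]
  have hU : ∀ t ∈ Ico 0 T, ((U t : L2C) : ℝ³ → ℂ³) =ᵐ[volume] complexify ∘ u t := fun t ht => by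
    rw [hU_eq t ht]
    exact (h2 t ht).coeFn_toLp
  have h0T : (0 : ℝ) ∈ Ico 0 T := ⟨le_rfl, hT⟩
  -- (2) regularity of the curve and Tao's identity at viscosity `ν`
  have hH : ∀ t ∈ Ico 0 T, MemH10df (U t) := stub_memH10 hν hcl hLH hdec U hU
  have hc : ContinuousInH10On (Ico 0 T) U := stub_continuity hν hT hcl hLH hdec U hU
  have hid := stub_testToH10 U hH hc
    (stub_identityTests hν hT hcl hLH hdec U hU hH
      (fun hf h2 hH hdf hψ hψ1 hψ' hψ2 => stub_cubic hf h2 hH hdf hψ hψ1 hψ' hψ2))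
  -- (3) the datum as a Schwartz map
  obtain ⟨u₀, hu₀⟩ := exists_schwartzMap_coe_eq (hcl.contDiff_velocity h0T) hdec
  have hU0 : U 0 = schwartzL2 u₀ := by
    rw [hU_eq 0 h0T]
    exact MemLp.toLp_congr _ _ (Eventually.of_forall fun x => by rw [hu₀])
  -- (4) the Type-I rate in `L^∞` form
  have hrate : ∃ M : ℝ, ∀ t ∈ Ico 0 T,
      eLpNorm (U t) ⊤ volume ≤ ENNReal.ofReal (M / Real.sqrt (T - t)) := by
    refine ⟨C, fun t ht => ?_⟩
    have hpos : 0 < Real.sqrt (T - t) := Real.sqrt_pos.2 (sub_pos.2 ht.2)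
    rw [eLpNorm_congr_ae (hU t ht), eLpNorm_exponent_top]
    refine eLpNormEssSup_le_of_ae_bound (Eventually.of_forall fun x => ?_)
    rw [Function.comp_apply, norm_complexify, le_div_iff₀ hpos, mul_comm]
    exact hC t ht x
  -- (5) normalise the viscosity and apply the Thesis to the Euler datum
  obtain ⟨hW, M, hM⟩ := stub_normalise hν u₀ U hU0 hH hc hid hrate
  have hdiv₀ : VectorCalculus.IsDivFree ⇑((ν⁻¹ : ℝ) • u₀) := by
    have h1 : ContDiff ℝ 1 (u 0) := (hcl.contDiff_velocity h0T).of_le (mod_cast le_top)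
    have h := isDivFree_const_smul h1 (hcl.divFree 0 h0T) ν⁻¹
    rwa [← hu₀] at h
  obtain ⟨T', hT', v, hv, hvW⟩ := hTh AveragingDatum.euler AveragingDatum.euler_isSymmetric
    AveragingDatum.euler_hasCancellation ((ν⁻¹ : ℝ) • u₀) hdiv₀ (ν * T) (mul_pos hν hT) _ hW ⟨M, hM⟩
  have hv' : IsMildSolutionFor AveragingDatum.euler.form (schwartzL2 ((ν⁻¹ : ℝ) • u₀)) (Ico 0 T') v := hv
  -- (6) the back end
  refine stub_backEnd (a := ν⁻¹) (b := ν) hν hT (inv_pos.2 hν) hν hT' hcl hLH hdec v hv'.1 hv'.2.1 ?_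
  intro t ht
  have hνt : ν * t ∈ Ico 0 (ν * T) := ⟨mul_nonneg hν.le ht.1, mul_lt_mul_of_pos_left ht.2 hν⟩
  rw [hvW (ν * t) hνt, mul_div_cancel_left₀ t hν.ne']
  filter_upwards [Lp.coeFn_smul (((ν⁻¹ : ℝ) : ℂ)) (U t), hU t ht] with x hx hx'
  rw [hx, Pi.smul_apply, hx', Function.comp_apply]

end Summit.NavierStokesRegularity.NavierStokesRegularity.Cruxes.EulerTypeIGlue.Lines.Sketch

end
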